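import Literature.IUT.HodgeArakelov.PlusMinusTowerStableCurveBridge

/-!
# Bridge B13, Galois part: "`Π^±_{v□} ↠ G_v` relative to `Π_v`" transported from [IUTchI] Cor 2.3 (iii)

Mochizuki, *Inter-universal Teichmüller Theory II*, kurims manuscript (Dec. 2020), §2, Def 2.3 (i) p.67
("`Π^±_{v▶} := N_{Π^±_v}(Π_{v▶})` … [cf. [IUTchI], Corollary 2.3, (iv)]"), Cor 2.4 (ii) p.70; *Inter-universal
Teichmüller Theory I*, kurims manuscript (May 2020), §2, Cor 2.3 (iii) p.47 ("natural exact sequences of center-free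
topological groups `1 → Δ^tp_{X,ℍ} → Π^tp_{X,ℍ} → G_k → 1`") [cite: Mochizuki2012, II Def 2.3 (i) p.67, II Cor 2.4 (ii) p.70, I Cor 2.3 (iii) p.47]
(D-0012 claim key, status disputed; a BRIDGE between two landed typings — NOTHING of the series is asserted: every
printed input stays a hypothesis, named by the tree's L5 declarations).

PROOF-ONLY sequel (abc-iut cell, seat abc-iut-w5-d184; sub-DAG `plan/L6/SUBDAG-IUTchII-Cor-24.md` row Cor-24.ii.r4)
of abc-iut-L6-t7's `PlusMinusTowerStableCurveBridge.lean` (p412701: `PlusMinusTower.StableCurveAgreement W C D` between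
abc-iut-L6-t1's `±`-tower and abc-iut-L5-t1's `StableCurveTemperedData`).  No new definitions; landed modules untouched.

WHAT IS PROVED.  Input (S) of the Cor 2.4 (ii)(a) sub-DAG (hypothesis `hsurj` of
`Literature.IUT.HodgeArakelov.cuspDecomp_one_le_box_of_cor24_i`, file `LabelClassesOfCuspsCor24iiProofs.lean`):
"every `n ∈ Π_v` has the same image in `G_v` as some `m ∈ Π^±_{v□} = N_{Π^±_v}(Π_{v□})`, i.e. `m⁻¹n ∈ Δ̂^cor_v`" —
from [IUTchI] Cor 2.3 (iii) in abc-iut-L5-t1's vocabulary (`D.Cor23iii`: surjectivity of `Π^tp_{X_v,ℍ} ↠ G_v`, under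
`D.Cor23Hyp`), BOTH AS HYPOTHESES, along the agreement `A` and ONE `Π`-level dictionary entry stated inline:
`hBox` — "`Π^±_{v□} ⊆ Π̂^±_v` is carried by `eHat : Π̂^±_v ⥲ Π̂_{X_v}` onto `Π^tp_{X_v,ℍ} ↪ Π̂_{X_v}`" (Def 2.3 (i):
`Π^±_{v□}` IS the decomposition group `Π^tp_{X_v,ℍ}` of [IUTchI] Cor 2.3 (iii)/(iv) for the `G_v`-stable subgraph
`ℍ ∈ {Γ^{•t}_X, Γ^▶_X}`; the landed `SubgraphDictionary` carries the `Δ`-level entry `Δ^±_{v□} = Δ^tp_{X,ℍ}` only).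
So, exactly as for `h25`/`h23v` in part 1/2, hypothesis (S) becomes a one-line instance of an [IUTchI] §2 node.
Nothing here takes a side on [IUTchIII] Cor. 3.12; typed ≠ discharged.
-/

namespace Literature.IUT.HodgeArakelov

open Literature.IUT.HodgeTheaters

universe u

variable {S : BadPlaceSetting.{u}} {P : TopGroup.{u}} {T : TemperedCoverings S P}

namespace PlusMinusTower

namespace StableCurveAgreement

variable {W : PlusMinusTower T} {C : CuspidalInertiaData W} {D : StableCurveTemperedData.{u}}

/-- **IUTchI:Cor2.3(iii)** (kurims I p.47) **transported = input (S) "`Π^±_{v□} ↠ G_v` relative to `Π_v`" of the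
Cor 2.4 (ii)(a) sub-DAG** ([IUTchII] Cor 2.4 (ii) p.70, row Cor-24.ii.r4): under the agreement `A` and the `Π`-level
dictionary entry `hBox` ("`Π^±_{v□}` corresponds to `Π^tp_{X_v,ℍ}`"), the exactness `Π^tp_{X_v,ℍ} ↠ G_v` of [IUTchI]
Cor 2.3 (iii) (`D.Cor23iii`, under its hypothesis `D.Cor23Hyp`) — BOTH HYPOTHESES in abc-iut-L5-t1's vocabulary —
yields: for every `n ∈ Π_v` there is `m ∈ Π^±_{v□}` with `m⁻¹ n ∈ Δ̂^cor_v = Ker(Π̂^cor_v ↠ G_v)`.  PROVED.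
[claim: Mochizuki2012, status: disputed] -/
theorem boxOntoGalois_of_cor23iii (A : StableCurveAgreement W C D) {H : Subgroup P}
    (hBox : ((W.pmBox H).subgroupOf W.pmHat).map A.eHat.toMonoidHom = D.piTpXH.map D.ιX)
    (hHyp : D.Cor23Hyp) (h23iii : D.Cor23iii) :
    ∀ n : W.Corhat, n ∈ W.piV → ∃ m : W.Corhat, m ∈ W.pmBox H ∧ m⁻¹ * n ∈ W.aug.ker := by
  intro n hnV
  have hnPM : n ∈ W.piPM := by
    obtain ⟨y, rfl⟩ := hnV
    exact ⟨T.incl y, rfl⟩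
  have hnHat : n ∈ W.pmHat := W.emb_le_pmHat hnPM
  -- `n` corresponds to an element `p` of `Π^tp_{X_v}`
  obtain ⟨p, hp⟩ := (A.mem_piPM_iff ⟨n, hnHat⟩).mp hnPM
  -- [IUTchI] Cor 2.3 (iii): `Π^tp_{X,ℍ} ↠ G_v`; pick `x ∈ Π^tp_{X,ℍ}` over the image of `p`
  obtain ⟨x, hx⟩ := (h23iii.exact_tp hHyp).2 (D.prTp p)
  rw [MonoidHom.comp_apply, Subgroup.coe_subtype] at hx
  -- `ιX x` lies in the image of `Π^±_{v□}` under `eHat`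
  have hxBox : D.ιX (x : D.PiTp) ∈ ((W.pmBox H).subgroupOf W.pmHat).map A.eHat.toMonoidHom := by
    rw [hBox]
    exact ⟨x, x.2, rfl⟩
  obtain ⟨q, hq, hqx⟩ := hxBox
  rw [MulEquiv.coe_toMonoidHom] at hqx
  refine ⟨(q : W.Corhat), Subgroup.mem_subgroupOf.mp hq, ?_⟩
  -- `q⁻¹ n ∈ Δ̂^cor_v` iff its `eHat`-image lies in `Δ̂_{X_v} = Ker(Π̂_{X_v} ↠ G_v)`
  have hmem : ((q⁻¹ * ⟨n, hnHat⟩ : W.pmHat) : W.Corhat) ∈ W.aug.ker := by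
    rw [A.mem_ker_iff, map_mul, map_inv, hqx, ← hp, MonoidHom.mem_ker, map_mul, map_inv,
      ← MonoidHom.comp_apply, ← MonoidHom.comp_apply, D.prHat_comp, hx, inv_mul_cancel]
  simpa using hmem

end StableCurveAgreement

end PlusMinusTower

end Literature.IUT.HodgeArakelov
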